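import Summits.CriticalPhenomena.SAWScalingLimit.Theses.SAWWeldingIdentification
import Summits.CriticalPhenomena.SAWScalingLimit.Theorems.SAWRenewalTightnessEventualTightSplit
import Summits.CriticalPhenomena.SAWScalingLimit.Theorems.SAWRenewalTightnessEventualTightOfItems
import HarnessLib

/-!
# `EventualTight` on route `SAWWeldingIdentification`: the split glue (crux-strategist s3)

Crux `stmt-CriticalPhenomena-1372` is the decl `EventualTight` of route `SAWWeldingIdentification`
(rank 4, the precompactness binder `hT` of its deciding theorem `closes`).  Its body is byte-identical
to `SAWRenewalTightness.EventualTight` (one shared item), so every landed rung of the tightness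
programme applies to this route's copy by unfolding.

This file proves, from LANDED theorems only, the glue of the LOSSLESS decomposition

    SAWWeldingIdentification.EventualTight ⟸ ConfinementPositivity (stmt-17587) ∧ BulkShellTight (stmt-17588)

(`EventualTightSWI_of_subs`, hypotheses = the two item bodies verbatim), together with the finer
leaf form through the bulk atom `VirginArcTraversalTight` (stmt-17940, X2c₁)
(`EventualTightSWI_of_items`) and the two bridges between the route copies.  Both children are
consequences of the conjunct `SAWScalingLimit` (`TightnessNecessary` + `bulkShellTight_of_eventualTight`;
`confinementPositivity_of_scalingLimit`, p105757), so the split adds no bet to the welding route.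
Nothing here is new mathematics: `Theorems.EventualTight_of_subs` (= `TightOfShellCrossing_proof ∘
ShellCrossingBound_of_subs`, Aizenman–Burchard) and `Theorems.EventualTight_of_items` are landed.
[cite: AizenmanBurchardDuke1999, Thms 1.1–1.2 and Lemma 3.1] [cite: KemppainenSmirnov2017, Thm 1.5]
-/

namespace Summit.CriticalPhenomena.SAWScalingLimit.Theorems.SAWWeldingIdentificationSplit

open Literature.Probability.RandomPlanarGeometry Literature.Probability.LatticeModels
open Summit.CriticalPhenomena.SAWScalingLimit.Theses

/-- The two route copies of the shared crux are the same proposition (identical bodies). -/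
theorem eventualTight_iff_renewal :
    SAWWeldingIdentification.EventualTight ↔ SAWRenewalTightness.EventualTight :=
  Iff.rfl

/-- Bridge: the `SAWRenewalTightness` copy of the crux gives the `SAWWeldingIdentification` copy. -/
theorem eventualTightSWI_of_renewal :
    SAWRenewalTightness.EventualTight → SAWWeldingIdentification.EventualTight :=
  fun h => h

/-- **Split glue for route `SAWWeldingIdentification` (crux stmt-CriticalPhenomena-1372):**
restriction positivity for nested Dobrushin domains with common marked-point sockets
(`ConfinementPositivity`, stmt-17587, body verbatim) plus per-shell tightness of the traversal count on
interior shells (`BulkShellTight`, stmt-17588, body verbatim) imply eventual tightness of the pushed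
critical `ℤ²` SAW laws — the route decl `SAWWeldingIdentification.EventualTight` BY NAME.
Proof: the landed `Theorems.EventualTight_of_subs` (Aizenman–Burchard via `ShellCrossingBound_of_subs`)
read at this route's copy of the shared decl.
[cite: AizenmanBurchardDuke1999, Thms 1.1–1.2 and Lemma 3.1] -/
theorem EventualTightSWI_of_subs :
    (∀ (D D' : DobrushinDomain) (a b : ℝ → Site 2) (d : ℝ), 0 < d →
      D'.carrier ⊆ D.carrier → D'.pt 0 = D.pt 0 → D'.pt 1 = D.pt 1 →
      D.carrier ∩ (Metric.ball (D.pt 0) d ∪ Metric.ball (D.pt 1) d) ⊆ D'.carrier →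
      SAW.IsEndpointApprox D' a b →
        ∃ c δ₀ : ℝ, 0 < c ∧ 0 < δ₀ ∧ ∀ δ ∈ Set.Ioc (0 : ℝ) δ₀,
          ENNReal.ofReal c ≤ SAW.law D.carrier δ (a δ) (b δ)
            {γ | ∃ γ' : SAW.DomainSAW D'.carrier δ (a δ) (b δ),
              γ'.walk.support = γ.walk.support}) →
    (∀ (D : DobrushinDomain) (a b : ℝ → Site 2), SAW.IsEndpointApprox D a b →
      ∀ (y : ℂ) (η R : ℝ), 0 < η → η < R → Metric.closedBall y (2 * R) ⊆ D.carrier →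
        ∀ ε : ℝ, 0 < ε → ∃ (j : ℕ) (δ₁ : ℝ), 0 < δ₁ ∧ ∀ δ ∈ Set.Ioc (0 : ℝ) δ₁,
          SAW.law D.carrier δ (a δ) (b δ)
            {γ | (⟨γ.walk.toCurve (meshPoint δ)⟩ : Curve ℂ).HasTraversals j y η R} ≤
            ENNReal.ofReal ε) →
    Summit.CriticalPhenomena.SAWScalingLimit.Theses.SAWWeldingIdentification.EventualTight :=
  fun hE hB => Theorems.EventualTight_of_subs hE hB

/-- The same glue with the children named as the ROUTE DECLS of `SAWRenewalTightness` (items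
stmt-17587 / stmt-17588, whose bodies are the two hypotheses above): closing both items closes this
route's copy of the crux by `EventualTightSWI_of_children ConfinementPositivity_holds BulkShellTight_holds`. -/
theorem EventualTightSWI_of_children :
    SAWRenewalTightness.ConfinementPositivity → SAWRenewalTightness.BulkShellTight →
      SAWWeldingIdentification.EventualTight :=
  fun hE hB => Theorems.EventualTight_of_subs hE hB

/-- The finer leaf form: the bulk lattice atom `VirginArcTraversalTight` (stmt-17940, X2c₁) and
`ConfinementPositivity` (stmt-17587) imply this route's copy of the crux — the landed
`Theorems.EventualTight_of_items` read at `SAWWeldingIdentification.EventualTight`. -/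
theorem EventualTightSWI_of_items :
    SAWExcursionCardy.VirginArcTraversalTight → SAWRenewalTightness.ConfinementPositivity →
      SAWWeldingIdentification.EventualTight :=
  fun hX hE => Theorems.EventualTight_of_items hX hE

end Summit.CriticalPhenomena.SAWScalingLimit.Theorems.SAWWeldingIdentificationSplit
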